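import Literature.Barriers.CriticalPhenomena.RigorousRGSmallParameterLocOperator
import Literature.Barriers.CriticalPhenomena.RigorousRGSmallParameterTphiLaplacian
import Literature.Barriers.CriticalPhenomena.RigorousRGSmallParameterLocalPolynomial
import HarnessLib

/-!
# `RigorousRGSmallParameter` (Slade, Theorem 1.4.1): [BS-rg-loc] Lemma 3.2.2 —
# `‖M_{m,a}‖_{T_0(𝔥,R)} ≤ 𝔥^{p(m)}R^{-|α(m)|₁}` and `‖P̂_{m,x}‖_{T_0(𝔥,R)} ≤ 𝔥^{p(m)}R^{-|α(m)|₁}`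

Companion ("proof architecture") file of
`Literature/Barriers/CriticalPhenomena/RigorousRGSmallParameter.lean`, first brick of the norm
estimates for the localisation operator ([BS-rg-loc] §2.2/§3, Propositions 1.4.5–1.4.6: "It is
shown in Lemmas (lem:Pmbdpf) and (lem:TayX) that `‖P̂_{m,0}‖_{T_0} ≤ R^{-|α(m)|_1}𝔥^m`,
`‖f_{m'}^{(a)}‖_{Φ(U)} ≤ C̄𝔥^{-m'}R^{|α(m')|_1}`"), which control the contraction of `K` in Slade's
Theorem 6.3.1. [BS-rg-loc] Lemma 3.2.2: "For `m ∈ 𝔳_+` … `‖P̂_{m,x}‖_{T_0} ≤ R^{-|α(m)|_1}𝔥^m` …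
Proof. `P̂_m` is a sum of monomials of the same degree and dimension as `M_m`, so it suffices to
prove (e:Pbdpf) for a single such monomial `M̃_m`. But for any test function `g`, by (Mmg) and by
the definition of the `Φ(𝔥)` norm, `|⟨M̃_{m,x}, g⟩_0| = |∇^{α̃(m)}(Sg)_z|_{z=x⃗}| ≤
R^{-|α(m)|_1}𝔥^m‖Sg‖_{Φ(𝔥)} ≤ R^{-|α(m)|_1}𝔥^m‖g‖_{Φ(𝔥)}`." Here (one boson species, real
field, `𝔥^m = 𝔥^{p(m)}`) the symmetrisation `S` is realised by the slot contractions `T_c` of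
`…LocalMonomials` (`⟨M_{m,a},g⟩_0 = (T_{c_p}∘⋯∘T_{c_1}g)_∅`), and the proof is an invariant
("slot bound") propagated along that fold. All PROVED, 0 sorry:

* List/programme calculus (namespace `Tphi`): `modify_insertIdx_of_lt/_of_le`, `bumpAt`,
  `shiftAt_insertIdx`, **`napply_comp_insertIdx`** (`∇^β(w ↦ H(w ⊲_k y))(v) = (∇^{bump_kβ}H)(v ⊲_k y)`),
  `bumpAt_injective`, `bumpAt_ne`, `countAt_map_slot`, **`adm_relabel_append_slot`**, `SlotBd`,
  `slotBd_of_mem_ball`.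
* Namespace `Loc`: `napply_finsetSum`, `napply_const_mul_sum`, **`slotBd_slotOp`** (`T_{(i,α)}`
  improves the slot bound by `𝔥R^{-|α|}`), `slotBd_foldl`, **`abs_TphiPairing_monomial_zero_le`**,
  **`TphiNorm_monomial_zero_le`**, `abs_sgnM`, `forall_length_le_flipM`, **`TphiNorm_phat_zero_le`**.

Sources: D. C. Brydges, G. Slade, *A renormalisation group method. II. Approximation by local
polynomials*, J. Stat. Phys. 159 (2015) 461–491, arXiv:1403.7253, Lemma 3.2.2 and §2.2 (display
(e:PhatPhibd)), TeX-source numbering.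

## References

* [BrydgesSlade2015RGII] D. C. Brydges, G. Slade, *A renormalisation group method. II.
  Approximation by local polynomials*, J. Stat. Phys. **159** (2015) 461–491, arXiv:1403.7253.
-/

noncomputable section

namespace Literature.Barriers.CriticalPhenomena

namespace LongRangePhi4

namespace Tphi

open Finset

section SlotCalculus

variable {Λ : Type*} [AddCommGroup Λ] {ι : Type*} {S : Type*} (step : S → Λ)

/-- Modifying a slot `j < k` commutes with inserting at `k`. [folklore] -/
theorem modify_insertIdx_of_lt {α : Type*} (f : α → α) :
    ∀ (j k : ℕ) (v : List α) (y : α), j < k → k ≤ v.length →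
      (v.insertIdx k y).modify j f = (v.modify j f).insertIdx k y
  | j, 0, v, y, h, _ => absurd h (Nat.not_lt_zero _)
  | j, k + 1, [], y, _, h => by simp at h
  | 0, k + 1, b :: v, y, _, _ => by simp [List.insertIdx_succ_cons]
  | j + 1, k + 1, b :: v, y, hjk, hk => by
      rw [List.insertIdx_succ_cons, List.modify_succ_cons, List.modify_succ_cons, List.insertIdx_succ_cons,
        modify_insertIdx_of_lt f j k v y (by omega) (by simpa using hk)]

/-- Modifying a slot `j ≥ k` of `v` corresponds to slot `j+1` after inserting at `k`. [folklore] -/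
theorem modify_insertIdx_of_le {α : Type*} (f : α → α) :
    ∀ (j k : ℕ) (v : List α) (y : α), k ≤ j → k ≤ v.length →
      (v.insertIdx k y).modify (j + 1) f = (v.modify j f).insertIdx k y
  | j, 0, v, y, _, _ => by simp
  | j, k + 1, [], y, _, h => by simp at h
  | 0, k + 1, b :: v, y, h, _ => absurd h (by omega)
  | j + 1, k + 1, b :: v, y, hjk, hk => by
      rw [List.insertIdx_succ_cons, List.modify_succ_cons, List.modify_succ_cons, List.insertIdx_succ_cons,
        modify_insertIdx_of_le f j k v y (by omega) (by simpa using hk)]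

/-- The slot relabelling that skips slot `k`. [folklore] -/
def bumpAt (k j : ℕ) : ℕ := if j < k then j else j + 1

/-- Shifting a slot of `v` and then inserting at `k` = inserting and shifting the bumped slot. [folklore] -/
theorem shiftAt_insertIdx (j k : ℕ) (s : Λ) (v : List (Λ × ι)) (y : Λ × ι) (hk : k ≤ v.length) :
    shiftAt (bumpAt k j) s (v.insertIdx k y) = (shiftAt j s v).insertIdx k y := by
  unfold shiftAt bumpAt
  by_cases h : j < k
  · rw [if_pos h, modify_insertIdx_of_lt _ j k v y h hk]
  · rw [if_neg h, modify_insertIdx_of_le _ j k v y (by omega) hk]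

/-- **`∇^β` through an insertion**: `∇^β(w ↦ H(w ⊲_k y))(v) = (∇^{bump_k β} H)(v ⊲_k y)`. [folklore] -/
theorem napply_comp_insertIdx (k : ℕ) (y : Λ × ι) (H : List (Λ × ι) → ℝ) :
    ∀ (β : List (ℕ × S)) (v : List (Λ × ι)), k ≤ v.length →
      napply step β (fun w => H (w.insertIdx k y)) v = napply step (relabel (bumpAt k) β) H (v.insertIdx k y)
  | [], v, _ => rfl
  | q :: β, v, hk => by
      rw [napply_cons, relabel_cons, napply_cons]
      simp only [diffOp]
      rw [napply_comp_insertIdx k y H β v hk,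
        napply_comp_insertIdx k y H β (shiftAt q.1 (step q.2) v) (by simpa using hk),
        shiftAt_insertIdx q.1 k (step q.2) v y hk]

/-- `bumpAt k` is injective. [folklore] -/
theorem bumpAt_injective (k : ℕ) : Function.Injective (bumpAt k) := by
  intro i j h
  unfold bumpAt at h
  split_ifs at h <;> omega

/-- `bumpAt k` never hits `k`. [folklore] -/
theorem bumpAt_ne (k j : ℕ) : bumpAt k j ≠ k := by
  unfold bumpAt; split_ifs <;> omega

/-- `countAt` of a one-slot programme. [folklore] -/
theorem countAt_map_slot (k : ℕ) (l : List S) (p : ℕ) :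
    countAt p (l.map fun s => (k, s)) = if p = k then l.length else 0 := by
  induction l with
  | nil => simp [countAt]
  | cons s l ih =>
      simp only [countAt, List.map_cons, List.count_cons, List.length_cons] at ih ⊢
      rw [ih]
      by_cases h : p = k
      · subst h; simp
      · simp [h, Ne.symm h]

omit [AddCommGroup Λ] in
/-- **Admissibility of the combined programme** `bump_k β ∘ (α at slot k)` on `v ⊲_k y`. [folklore] -/
theorem adm_relabel_append_slot {pΦ : ℕ} {k : ℕ} {v : List (Λ × ι)} (hk : k ≤ v.length) {β : List (ℕ × S)}
    (hβ : Adm pΦ v.length β) {l : List S} (hl : l.length ≤ pΦ) :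
    Adm pΦ (v.length + 1) (relabel (bumpAt k) β ++ l.map fun s => (k, s)) := by
  refine ⟨fun q hq => ?_, fun p => ?_⟩
  · rcases List.mem_append.1 hq with hq | hq
    · obtain ⟨q', hq', rfl⟩ := List.mem_map.1 hq
      have := hβ.1 q' hq'
      simp only [bumpAt]
      split_ifs <;> omega
    · obtain ⟨s, -, rfl⟩ := List.mem_map.1 hq
      simp only
      omega
  · rw [countAt_append, countAt_map_slot]
    by_cases hp : p = k
    · subst hp
      rw [countAt_relabel_eq_zero (fun q _ => bumpAt_ne p q.1), if_pos rfl, zero_add]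
      exact hl
    · rw [if_neg hp, add_zero]
      exact countAt_relabel_le hβ (bumpAt_injective k) p

variable [Fintype Λ] [Fintype ι]

/-- **The slot bound** `|∇^β h_v| ≤ s 𝔥^{|v|} R^{-|β|}` for all admissible `β` — the unit ball of
`Φ(𝔥,R)` is `SlotBd 1`. [folklore] -/
def SlotBd (𝔥 R : ℝ) (pΦ : ℕ) (s : ℝ) (h : List (Λ × ι) → ℝ) : Prop :=
  ∀ (v : List (Λ × ι)) (β : List (ℕ × S)), Adm pΦ v.length β → |napply step β h v| ≤ s * 𝔥 ^ v.length * (R ^ β.length)⁻¹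

/-- Test functions in the unit ball satisfy the slot bound with `s = 1`. [folklore] -/
theorem slotBd_of_mem_ball {𝔥 R : ℝ} (h𝔥 : 0 < 𝔥) (hR : 0 < R) {pΦ pN : ℕ} {g : List (Λ × ι) → ℝ}
    (hg : g ∈ ball pN (latticeFamily step 𝔥 R pΦ)) : SlotBd step 𝔥 R pΦ 1 g := by
  intro v β hβ
  rw [one_mul]
  exact abs_napply_le_of_mem_ball step h𝔥 hR hg hβ

end SlotCalculus

end Tphi

namespace Loc

open Finset Tphi RGNorm LocalPoly Literature.Probability.LatticeModels
open scoped ContDiff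

variable {d M n : ℕ}

/-- `∇^β` of a finite sum of test functions. [folklore] -/
theorem napply_finsetSum {S : Type*} (step : S → TorusSite d M) (β : List (ℕ × S)) (t : Finset ℕ)
    (f : ℕ → List (TorusSite d M × Fin n) → ℝ) (v : List (TorusSite d M × Fin n)) :
    napply step β (∑ k ∈ t, f k) v = ∑ k ∈ t, napply step β (f k) v := by
  induction t using Finset.cons_induction with
  | empty => simp [napply_zero]
  | cons a t ha ih => rw [Finset.sum_cons, Finset.sum_cons, napply_add, Pi.add_apply, ih]

/-- `∇^β` of a scalar multiple of a finite sum. [folklore] -/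
theorem napply_const_mul_sum {S : Type*} (step : S → TorusSite d M) (β : List (ℕ × S)) (c : ℝ) (t : Finset ℕ)
    (f : ℕ → List (TorusSite d M × Fin n) → ℝ) (v : List (TorusSite d M × Fin n)) :
    napply step β (fun w => c * ∑ k ∈ t, f k w) v = c * ∑ k ∈ t, napply step β (f k) v := by
  have h1 : (fun w => c * ∑ k ∈ t, f k w) = c • (∑ k ∈ t, f k) := by
    funext w; simp [Finset.sum_apply, smul_eq_mul]
  rw [h1, napply_smul, Pi.smul_apply, smul_eq_mul, napply_finsetSum]

/-- **The slot contraction improves the slot bound by `𝔥 R^{-|α|}`**: if `|∇^β h_v| ≤ s𝔥^{|v|}R^{-|β|}`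
for all admissible `β`, then `T_{(i,α)} h` satisfies the same with `s𝔥R^{-|α|}` (`|α| ≤ p_Φ`).
[cite: BrydgesSlade2015RGII, Lemma 3.2.2 (‖P̂_{m,0}‖_{T_0} ≤ R^{-|α(m)|₁}𝔥^m)] -/
theorem slotBd_slotOp {𝔥 R : ℝ} (h𝔥 : 0 < 𝔥) (hR : 0 < R) {pΦ : ℕ} {s : ℝ}
    {h : List (TorusSite d M × Fin n) → ℝ} (hh : SlotBd (unitStep d M) 𝔥 R pΦ s h) (a : TorusSite d M)
    (c : Fin n × List (Fin d × Bool)) (hc : c.2.length ≤ pΦ) :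
    SlotBd (unitStep d M) 𝔥 R pΦ (s * 𝔥 * (R ^ c.2.length)⁻¹) (slotOp a c h) := by
  intro v β hβ
  -- freeze the length-dependent constants of `slotOp` at `|v|`
  have hloc : napply (unitStep d M) β (slotOp a c h) v =
      napply (unitStep d M) β (fun w => ((v.length + 1 : ℕ) : ℝ)⁻¹ *
        ∑ k ∈ range (v.length + 1), napply (unitStep d M) (c.2.map fun s => (k, s)) h (w.insertIdx k (a, c.1))) v :=
    napply_congr (unitStep d M) β (r := v.length) (fun w hw => by simp only [slotOp, hw]) v rfl
  rw [hloc, napply_const_mul_sum]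
  have hterm : ∀ k ∈ range (v.length + 1),
      |napply (unitStep d M) β (fun w => napply (unitStep d M) (c.2.map fun s => (k, s)) h (w.insertIdx k (a, c.1))) v| ≤
        s * 𝔥 ^ (v.length + 1) * (R ^ (β.length + c.2.length))⁻¹ := by
    intro k hk
    have hk' : k ≤ v.length := by rw [Finset.mem_range] at hk; omega
    rw [napply_comp_insertIdx (unitStep d M) k (a, c.1) _ β v hk', ← napply_append]
    have hadm := adm_relabel_append_slot (k := k) hk' hβ hc
    have h1 := hh (v.insertIdx k (a, c.1)) _ (by rw [List.length_insertIdx_of_le_length hk']; exact hadm)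
    rw [List.length_insertIdx_of_le_length hk', List.length_append, length_relabel, List.length_map] at h1
    exact h1
  have hN : (0 : ℝ) < ((v.length + 1 : ℕ) : ℝ) := by positivity
  calc |((v.length + 1 : ℕ) : ℝ)⁻¹ * ∑ k ∈ range (v.length + 1),
          napply (unitStep d M) β (fun w => napply (unitStep d M) (c.2.map fun s => (k, s)) h (w.insertIdx k (a, c.1))) v|
      ≤ ((v.length + 1 : ℕ) : ℝ)⁻¹ * ∑ k ∈ range (v.length + 1), s * 𝔥 ^ (v.length + 1) * (R ^ (β.length + c.2.length))⁻¹ := by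
        rw [abs_mul, abs_of_pos (inv_pos.2 hN)]
        exact mul_le_mul_of_nonneg_left ((Finset.abs_sum_le_sum_abs _ _).trans (Finset.sum_le_sum hterm)) (by positivity)
    _ = s * 𝔥 ^ (v.length + 1) * (R ^ (β.length + c.2.length))⁻¹ := by
        rw [Finset.sum_const, Finset.card_range, nsmul_eq_mul]; field_simp
    _ = s * 𝔥 * (R ^ c.2.length)⁻¹ * 𝔥 ^ v.length * (R ^ β.length)⁻¹ := by
        rw [pow_succ, pow_add, mul_inv]; ring

/-- The slot bound along the fold `T_{c_p} ∘ ⋯ ∘ T_{c_1}`. [folklore] -/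
theorem slotBd_foldl {𝔥 R : ℝ} (h𝔥 : 0 < 𝔥) (hR : 0 < R) {pΦ : ℕ} (a : TorusSite d M) :
    ∀ (m : List (Fin n × List (Fin d × Bool))) {s : ℝ} {h : List (TorusSite d M × Fin n) → ℝ},
      SlotBd (unitStep d M) 𝔥 R pΦ s h → (∀ c ∈ m, c.2.length ≤ pΦ) →
      SlotBd (unitStep d M) 𝔥 R pΦ (s * 𝔥 ^ m.length * (R ^ tordS m)⁻¹) (m.foldl (fun h c => slotOp a c h) h)
  | [], s, h, hh, _ => by simpa [tordS] using hh
  | c :: m, s, h, hh, hm => by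
      rw [List.foldl_cons]
      have h1 := slotBd_slotOp h𝔥 hR hh a c (hm c (by simp))
      have h2 := slotBd_foldl h𝔥 hR a m (s := s * 𝔥 * (R ^ c.2.length)⁻¹) h1 fun c' hc' => hm c' (by simp [hc'])
      have e : s * 𝔥 * (R ^ c.2.length)⁻¹ * 𝔥 ^ m.length * (R ^ tordS m)⁻¹ =
          s * 𝔥 ^ (c :: m).length * (R ^ tordS (c :: m))⁻¹ := by
        simp only [List.length_cons, tordS, List.map_cons, List.sum_cons, pow_succ, pow_add, mul_inv]
        ring
      rwa [e] at h2

/-- `|sgn(m)| = 1`. [folklore] -/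
theorem abs_sgnM (m'' : List (Fin n × List (Fin d × Bool))) : |sgnM m''| = 1 := by
  unfold sgnM
  induction m'' with
  | nil => simp
  | cons c m ih =>
      rw [List.map_cons, List.prod_cons, abs_mul, ih, mul_one]
      have h := sgnB_mul_self c.2
      have : |sgnB c.2| ^ 2 = 1 := by rw [sq_abs, sq, h]
      nlinarith [abs_nonneg (sgnB c.2)]

/-- Flips preserve the per-component orders. [folklore] -/
theorem forall_length_le_flipM {pΦ : ℕ} (S : Finset (Fin d)) {m'' : List (Fin n × List (Fin d × Bool))}
    (hm : ∀ c ∈ m'', c.2.length ≤ pΦ) : ∀ c ∈ flipM S m'', c.2.length ≤ pΦ := by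
  intro c hc
  obtain ⟨c', hc', rfl⟩ := List.mem_map.1 hc
  simpa using hm c' hc'

variable [NeZero M]

/-- **`|⟨M_{m,a}, g⟩_0| ≤ 𝔥^{p(m)} R^{-|α(m)|₁}` for `g ∈ B(Φ(𝔥,R))`** (each component carrying at most
`p_Φ` derivatives, `p_𝒩 ≥ 1`). [cite: BrydgesSlade2015RGII, Lemma 3.2.2] -/
theorem abs_TphiPairing_monomial_zero_le {𝔥 R : ℝ} (h𝔥 : 0 < 𝔥) (hR : 0 < R) {pΦ pN : ℕ} (hpN : 1 ≤ pN)
    (m : List (Fin n × List (Fin d × Bool))) (hm : ∀ c ∈ m, c.2.length ≤ pΦ) (a : TorusSite d M)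
    {g : List (TorusSite d M × Fin n) → ℝ} (hg : g ∈ ball pN (latticeFamily (unitStep d M) 𝔥 R pΦ)) :
    |TphiPairing pN (basisDir d M n) (monomial m a) 0 g| ≤ 𝔥 ^ m.length * (R ^ tordS m)⁻¹ := by
  rw [TphiPairing_monomial_zero hpN a m hg.1]
  have h := slotBd_foldl h𝔥 hR a m (slotBd_of_mem_ball (unitStep d M) h𝔥 hR hg) hm [] [] (adm_nil pΦ 0)
  simpa using h

/-- **[BS-rg-loc] Lemma 3.2.2 for monomials**: `‖M_{m,a}‖_{T_0(𝔥,R)} ≤ 𝔥^{p(m)} R^{-|α(m)|₁}`.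
[cite: BrydgesSlade2015RGII, Lemma 3.2.2 ("‖P̂_{m,0}‖_{T_0} ≤ R^{-|α(m)|_1}𝔥^m")] -/
theorem TphiNorm_monomial_zero_le {𝔥 R : ℝ} (h𝔥 : 0 < 𝔥) (hR : 0 < R) {pΦ pN : ℕ} (hpN : 1 ≤ pN)
    (m : List (Fin n × List (Fin d × Bool))) (hm : ∀ c ∈ m, c.2.length ≤ pΦ) (a : TorusSite d M) :
    TphiNorm pN (latticeFamily (unitStep d M) 𝔥 R pΦ) (basisDir d M n) (monomial m a) 0 ≤ 𝔥 ^ m.length * (R ^ tordS m)⁻¹ := by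
  unfold TphiNorm
  refine Tnorm_le fun g hg => ?_
  exact abs_TphiPairing_monomial_zero_le h𝔥 hR hpN m hm a hg

/-- **[BS-rg-loc] Lemma 3.2.2**: `‖P̂_{m,x}‖_{T_0(𝔥,R)} ≤ 𝔥^{p(m)} R^{-|α(m)|₁}` for the
symmetrised local monomials (average over the `2^d` axis flips of signed monomials, each bounded by
`TphiNorm_monomial_zero_le`). [cite: BrydgesSlade2015RGII, Lemma 3.2.2] -/
theorem TphiNorm_phat_zero_le {𝔥 R : ℝ} (h𝔥 : 0 < 𝔥) (hR : 0 < R) {pΦ pN : ℕ} (hpN : 1 ≤ pN)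
    (m' : List (Fin n × List (Fin d))) (hm : ∀ c ∈ m', c.2.length ≤ pΦ) (x : TorusSite d M) :
    TphiNorm pN (latticeFamily (unitStep d M) 𝔥 R pΦ) (basisDir d M n) (phat m' x) 0 ≤ 𝔥 ^ m'.length * (R ^ tordF m')⁻¹ := by
  have hfwd : ∀ c ∈ m'.map fwd, c.2.length ≤ pΦ := by
    intro c hc
    obtain ⟨c', hc', rfl⟩ := List.mem_map.1 hc
    simpa [fwd] using hm c' hc'
  have hmono : ∀ S : Finset (Fin d), ContDiff ℝ ∞ (fun φ : TorusSite d M → Fin n → ℝ =>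
      sgnM (flipM S (m'.map fwd)) * monomial (flipM S (m'.map fwd)) x φ) :=
    fun S => contDiff_const.mul (contDiff_monomial _ x)
  have hsum : ContDiff ℝ ∞ (fun φ : TorusSite d M → Fin n → ℝ =>
      ∑ S : Finset (Fin d), sgnM (flipM S (m'.map fwd)) * monomial (flipM S (m'.map fwd)) x φ) :=
    ContDiff.sum fun S _ => hmono S
  have e : phat (n := n) m' x = fun φ => ((2 : ℝ) ^ d)⁻¹ *
      ∑ S : Finset (Fin d), sgnM (flipM S (m'.map fwd)) * monomial (flipM S (m'.map fwd)) x φ := rfl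
  rw [e]
  refine (TphiNorm_const_mul_le h𝔥 hR pΦ pN _ hsum 0).trans ?_
  have hS : ∀ S : Finset (Fin d), TphiNorm pN (latticeFamily (unitStep d M) 𝔥 R pΦ) (basisDir d M n)
      (fun φ => sgnM (flipM S (m'.map fwd)) * monomial (flipM S (m'.map fwd)) x φ) 0 ≤ 𝔥 ^ m'.length * (R ^ tordF m')⁻¹ := by
    intro S
    refine (TphiNorm_const_mul_le h𝔥 hR pΦ pN _ (contDiff_monomial _ x) 0).trans ?_
    rw [abs_sgnM, one_mul]
    have h := TphiNorm_monomial_zero_le h𝔥 hR hpN (flipM S (m'.map fwd)) (forall_length_le_flipM S hfwd) x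
    rwa [length_flipM, List.length_map, tordS_flipM, tordS_map_fwd] at h
  -- the norm of the sum over flips
  have hsumle : TphiNorm pN (latticeFamily (unitStep d M) 𝔥 R pΦ) (basisDir d M n)
      (fun φ => ∑ S : Finset (Fin d), sgnM (flipM S (m'.map fwd)) * monomial (flipM S (m'.map fwd)) x φ) 0 ≤
      ∑ S : Finset (Fin d), (𝔥 ^ m'.length * (R ^ tordF m')⁻¹) := by
    have ec : coeffFamily (basisDir d M n)
        (fun φ => ∑ S : Finset (Fin d), sgnM (flipM S (m'.map fwd)) * monomial (flipM S (m'.map fwd)) x φ) 0 =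
        fun z => ∑ S : Finset (Fin d), coeffFamily (basisDir d M n)
          (fun φ => sgnM (flipM S (m'.map fwd)) * monomial (flipM S (m'.map fwd)) x φ) 0 z := by
      funext z
      simp only [coeffFamily]
      rw [coeff_finset_sum _ _ (fun S _ => hmono S) z]
    unfold TphiNorm
    rw [ec]
    exact (Tnorm_sum_le (latticeFamily_evalBound (unitStep d M) h𝔥 hR pΦ pN (ι := Fin n)) _ _).trans
      (Finset.sum_le_sum fun S _ => hS S)
  rw [Finset.sum_const, Finset.card_univ, Fintype.card_finset, Fintype.card_fin, nsmul_eq_mul] at hsumle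
  have h2 : (0 : ℝ) < (2 : ℝ) ^ d := by positivity
  rw [abs_of_pos (inv_pos.2 h2)]
  calc ((2 : ℝ) ^ d)⁻¹ * TphiNorm pN (latticeFamily (unitStep d M) 𝔥 R pΦ) (basisDir d M n)
        (fun φ => ∑ S : Finset (Fin d), sgnM (flipM S (m'.map fwd)) * monomial (flipM S (m'.map fwd)) x φ) 0
      ≤ ((2 : ℝ) ^ d)⁻¹ * (((2 ^ d : ℕ) : ℝ) * (𝔥 ^ m'.length * (R ^ tordF m')⁻¹)) :=
        mul_le_mul_of_nonneg_left hsumle (by positivity)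
    _ = 𝔥 ^ m'.length * (R ^ tordF m')⁻¹ := by push_cast; field_simp

end Loc

end LongRangePhi4

end Literature.Barriers.CriticalPhenomena
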